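import Mathlib.Analysis.Analytic.CPolynomial
import Mathlib.Analysis.Analytic.Constructions
import Mathlib.Analysis.Analytic.Uniqueness
import Mathlib.RingTheory.Norm.Defs
import Literature.NumberTheory.Automorphic.CentralDerivativesTranslationGL
import HarnessLib

/-!
# Central elements of `U(𝔤)` commute with right translations by ALL of `GL(N, A)`
# (`z ∘ r(h) = r(h) ∘ z` on smooth functions, every component of `GL_n(K_∞)`)

Topic `NumberTheory/Automorphic`; sequel of `CentralDerivativesTranslationGL`, which proves that
for the full linear group `H` (`H.lie = ⊤`, `H.carrier = ⊤`, `A` finite-dimensional; e.g.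
`G_∞ = GL_n(K_∞)`), a central word `p ∈ ℝ⟨𝔤⟩` and a function `φ` smooth in the archimedean
variable, `(Ad(exp Y) · p) φ = p φ` and hence `p (r(exp Y) φ) = r(exp Y) (p φ)` — the
infinitesimal form of the bi-invariance of `Z(𝔤)` on the identity component. The real places
of a number field give factors `GL_n(ℝ)` with two connected components, and the convolution
identity `D (α ∗ β) = (D α) ∗ β` for `D ∈ Z(𝔤)` (Borel 1997, 2.3 (3), consumed by the spectral
decomposition of cusp forms) needs `D ∘ r(y) = r(y) ∘ D` for EVERY `y`. This file PROVES it: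

* `applyFree_lift_Ad_of_isCentralWord` — `(Ad(h) · p) φ = p φ` for every `h ∈ GL(N, A)`;
* `applyFree_archTranslate_of_isCentralWord` — `p (r(h) φ) = r(h) (p φ)` for every `h`;
* `applyFree_rightTranslation_ofInfinite` — the `GL_n` datum: `p (r(x) φ) = r(x) (p φ)` for
  every `x ∈ GL_n(K_∞)`.

Proof ("a polynomial identity which holds on an open set holds everywhere"; cf. Knapp 2002,
Prop. 5.32 and VII.§2 property (iv): every `Ad(g)`, `g ∈ GL_n`, is inner on `𝔤_ℂ`, so `Z(𝔤)` is
`Ad(G)`-invariant although `G` is disconnected). Fix `φ`, `g`, and `u(k) = ((Ad(k) · p) φ)(g)`.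
Along the affine curve `c(t) = (1 - t) 1 + t h` from `1` to `h` write `p = ∑_w a_w X₁ ⋯ X_m` in
the word basis; `u(c(t)) = ∑_w a_w Λ_w(Ad(c t) X₁, …, Ad(c t) X_m)` with the continuous
multilinear maps `Λ_w(Z) = (Z₁ ⋯ Z_m φ)(g)` (`iterLieDerivCML`). With the norm `N : A → ℝ` of the
finite-dimensional real algebra `A` (determinant of the regular representation, Mathlib's
`Algebra.norm ℝ`, analytic: `analyticAt_algebraNorm`) and an analytic cofactor `cof a`
(`a · cof a = N(a)`, `exists_analytic_cofactor_algebraNorm`), `N(det c(t)) · Ad(c t) X =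
c(t) X (cof(det c(t)) · adj c(t))` is polynomial in `t`, so
`P(t) = ∑_w a_w N(det c(t))^{M - m_w} Λ_w(…)` is real-analytic on ALL of `ℝ` and equals
`N(det c(t))^M u(c(t))` whenever `c(t)` is invertible. Near `t = 0`, `c(t) = exp Y` and
`u(c(t)) = u(1)` by the identity-component theorem; by analytic continuation on the connected
line, `P(t) = N(det c(t))^M u(1)` for all `t`, and at `t = 1` (`c(1) = h`, `N(det h) ≠ 0`)
`u(h) = u(1)`. No structure theory of `Z(𝔤)` and no decomposition of `GL(N, A)` into components
is used.

Everything here is proved; there are no definitions and no named facts (the norm is Mathlib's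
`Algebra.norm ℝ`, the cofactor is produced by `exists_analytic_cofactor_algebraNorm`).

## References

* A. Borel, *Automorphic forms on SL₂(ℝ)*, Cambridge Tracts in Math. 130 (1997), 2.1, 2.3 (3),
  2.5 (PDF pp. 13–15 of the held copy) [Borel1997].
* A. Borel, H. Jacquet, *Automorphic forms and automorphic representations*, Proc. Sympos. Pure
  Math. 33 (Corvallis 1979), part 1, §1.6, 4.3 (ii) [BorelJacquetCorvallis1979].
* A. W. Knapp, *Lie Groups Beyond an Introduction*, 2nd ed. (2002), Prop. 5.32, VII.§2 [Knapp2002].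
* N. Bourbaki, *Algebra I*, III.§9.3 (norm of an element of a finite algebra as the determinant of
  multiplication) [folklore].
-/

-- Mathlib idiom (Mathlib/Algebra/Lie/OfAssociative.lean); needed to mention Lie subalgebras of matrix algebras
attribute [local instance 100] LieRing.ofAssociativeRing

open scoped MatrixGroups Matrix ContDiff Topology
open Filter

noncomputable section

namespace Literature.NumberTheory.Automorphic

/-! ### 1. Analytic matrix-valued families: determinant and adjugate are analytic -/

section AnalyticDet

variable {E : Type*} [NormedAddCommGroup E] [NormedSpace ℝ E] {m : Type*} [Fintype m]
  [DecidableEq m] {R : Type*} [NormedCommRing R] [NormedAlgebra ℝ R]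

/-- **The determinant of an analytic family of matrices is analytic** (Leibniz expansion: a finite
sum of finite products of the entries). [folklore] -/
theorem analyticAt_det_of_entries {F : E → Matrix m m R} {x : E}
    (hF : ∀ i j, AnalyticAt ℝ (fun y => F y i j) x) :
    AnalyticAt ℝ (fun y => (F y).det) x := by
  simp_rw [Matrix.det_apply']
  refine Finset.analyticAt_fun_sum _ fun σ _ => ?_
  exact analyticAt_const.mul (Finset.analyticAt_fun_prod _ fun i _ => hF (σ i) i)

/-- **The entries of the adjugate of an analytic family of matrices are analytic** (each is the
determinant of the family with one row replaced by a constant vector). [folklore] -/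
theorem analyticAt_adjugate_entry_of_entries {F : E → Matrix m m R} {x : E}
    (hF : ∀ i j, AnalyticAt ℝ (fun y => F y i j) x) (i j : m) :
    AnalyticAt ℝ (fun y => (F y).adjugate i j) x := by
  simp_rw [Matrix.adjugate_apply]
  refine analyticAt_det_of_entries fun a b => ?_
  by_cases h : a = j
  · simp_rw [Matrix.updateRow_apply, if_pos h]
    exact analyticAt_const
  · simp_rw [Matrix.updateRow_apply, if_neg h]
    exact hF a b

end AnalyticDet

/-! ### 2. The norm of a finite-dimensional commutative real algebra is analytic, with an analytic cofactor -/

section AlgebraNorm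

variable {A : Type*} [NormedCommRing A] [NormedAlgebra ℝ A] [FiniteDimensional ℝ A]

/-- The entries of the regular representation `a ↦ (matrix of x ↦ a x)` in a basis depend linearly,
hence analytically, on `a`. Bourbaki, *Algebra I*, III.§9.3. [folklore] -/
theorem analyticAt_toMatrix_lmul_entry {κ : Type*} [Fintype κ] [DecidableEq κ]
    (b : Module.Basis κ ℝ A) (i j : κ) (x : A) :
    AnalyticAt ℝ (fun a : A => LinearMap.toMatrix b b (Algebra.lmul ℝ A a) i j) x := by
  let L : A →ₗ[ℝ] ℝ :=
    { toFun := fun a => LinearMap.toMatrix b b (Algebra.lmul ℝ A a) i j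
      map_add' := fun a a' => by
        simp only [map_add, Matrix.add_apply]
      map_smul' := fun r a => by
        simp only [map_smul, Matrix.smul_apply, smul_eq_mul, RingHom.id_apply] }
  let Lc : A →L[ℝ] ℝ := ⟨L, L.continuous_of_finiteDimensional⟩
  exact Lc.analyticAt x

/-- **The algebra norm `N(a) = det (x ↦ a x)` of a finite-dimensional commutative real algebra is a
real-analytic (indeed polynomial) function of `a`.** Bourbaki, *Algebra I*, III.§9.3. [folklore] -/
theorem analyticAt_algebraNorm (x : A) : AnalyticAt ℝ (Algebra.norm ℝ : A → ℝ) x := by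
  set b := Module.finBasis ℝ A with hb
  have heq : (Algebra.norm ℝ : A → ℝ) =
      fun a => (LinearMap.toMatrix b b (Algebra.lmul ℝ A a)).det := by
    funext a
    rw [Algebra.norm_apply, LinearMap.det_toMatrix]
  rw [heq]
  exact analyticAt_det_of_entries fun i j => analyticAt_toMatrix_lmul_entry b i j x

/-- **An analytic cofactor for the algebra norm**: there is a real-analytic (indeed polynomial)
`cof : A → A` with `a · cof a = N(a) · 1` for all `a` — the element whose coordinates are
`adj(M_a) · (coords of 1)` for the matrix `M_a` of multiplication by `a` (`M · adj M = det M · 1`),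
i.e. the polynomial numerator of `a⁻¹ = cof a / N(a)`. Bourbaki, *Algebra I*, III.§9.4. [folklore] -/
theorem exists_analytic_cofactor_algebraNorm :
    ∃ cof : A → A, (∀ x, AnalyticAt ℝ cof x) ∧
      ∀ a : A, a * cof a = algebraMap ℝ A (Algebra.norm ℝ a) := by
  classical
  set b := Module.finBasis ℝ A with hb
  let Mm : A → Matrix (Fin (Module.finrank ℝ A)) (Fin (Module.finrank ℝ A)) ℝ :=
    fun a => LinearMap.toMatrix b b (Algebra.lmul ℝ A a)
  refine ⟨fun a => ∑ i, (Matrix.mulVec (Mm a).adjugate ⇑(b.repr 1) i) • b i, fun x => ?_,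
    fun a => ?_⟩
  · refine Finset.analyticAt_fun_sum _ fun i _ => ?_
    have hi : AnalyticAt ℝ (fun a : A => Matrix.mulVec (Mm a).adjugate ⇑(b.repr 1) i) x := by
      simp only [Matrix.mulVec, dotProduct]
      refine Finset.analyticAt_fun_sum _ fun j _ => ?_
      exact (analyticAt_adjugate_entry_of_entries
        (fun i j => analyticAt_toMatrix_lmul_entry b i j x) i j).mul analyticAt_const
    exact hi.smul analyticAt_const
  · have hrepr : ∀ x : A, ⇑(b.repr (a * x)) = Matrix.mulVec (Mm a) ⇑(b.repr x) := fun x => by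
      rw [LinearMap.toMatrix_mulVec_repr b b (Algebra.lmul ℝ A a) x]
      rfl
    have hcof : ⇑(b.repr (∑ i, (Matrix.mulVec (Mm a).adjugate ⇑(b.repr 1) i) • b i)) =
        Matrix.mulVec (Mm a).adjugate ⇑(b.repr 1) := by
      rw [← Module.Basis.equivFun_symm_apply, ← Module.Basis.equivFun_apply,
        LinearEquiv.apply_symm_apply]
    have hnorm : Algebra.norm ℝ a = (Mm a).det := by
      rw [Algebra.norm_apply, LinearMap.det_toMatrix]
    apply b.repr.injective
    apply DFunLike.coe_injective
    rw [hrepr, hcof, Matrix.mulVec_mulVec, Matrix.mul_adjugate, Matrix.smul_mulVec,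
      Matrix.one_mulVec, Algebra.algebraMap_eq_smul_one, map_smul, Finsupp.coe_smul, hnorm]

end AlgebraNorm

/-! ### 3. `Ad(h)` acts trivially on central words through smooth functions, for every `h` -/

section Central

variable {A : Type*} [NormedCommRing A] [NormedAlgebra ℝ A] [NormedAlgebra ℚ A] [CompleteSpace A]
  [StarRing A] {N : Type*} [Fintype N] [DecidableEq N] {H : RealMatrixGroup A N}
  {G : Type*} [Group G] (ι : H.carrier →* G)

variable [FiniteDimensional ℝ A]

-- the scoped `L∞`-operator normed structure on matrices (only reducibly defeq to the Pi one), as in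
-- `CentralDerivativesTranslationGL` and `Mathlib/Analysis/Normed/Algebra/MatrixExponential.lean`
set_option backward.isDefEq.respectTransparency false in
open scoped Matrix.Norms.Operator in
/-- **`Ad(h)` acts trivially on central words, through smooth functions, for EVERY `h ∈ GL(N, A)`**:
for `p ∈ ℝ⟨𝔤⟩` central (`𝔤 = 𝔤𝔩(N, A)`, `A` finite-dimensional), `φ` smooth in the archimedean
variable and any `h`, `(Ad(h) · p) φ = p φ`. Proof by analytic continuation along the affine curve
`c(t) = (1-t) 1 + t h` from the identity-component case
(`applyFree_lift_Ad_expMem_of_isCentralWord`); see the module docstring. Borel 1997, 2.5 (`Z(𝔤)` =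
bi-invariant operators); Knapp 2002, Prop. 5.32 and VII.§2 (iv). [cite: Borel1997, 2.5 (PDF p. 15)] -/
theorem applyFree_lift_Ad_of_isCentralWord (hH : H.lie = ⊤) (hc : H.carrier = ⊤)
    (h : H.carrier) {p : FreeAlgebra ℝ H.lie} (hp : IsCentralWord p) {φ : G → ℂ}
    (hφ : IsArchSmooth ι φ) :
    applyFree ι (FreeAlgebra.lift ℝ (FreeAlgebra.ι ℝ ∘ H.Ad h) p) φ = applyFree ι p φ := by
  classical
  funext g₀
  set b := FreeAlgebra.basisFreeMonoid ℝ H.lie with hb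
  let ψ : archSmooth ι := ⟨φ, (mem_archSmooth_iff ι φ).2 hφ⟩
  -- `u k = ((Ad(k) · p) φ)(g₀)`
  let u : H.carrier → ℂ := fun k =>
    applyFree ι (FreeAlgebra.lift ℝ (FreeAlgebra.ι ℝ ∘ H.Ad k) p) φ g₀
  -- the algebra norm of `A` and an analytic cofactor
  obtain ⟨cof, hcof_an, hmul_cof⟩ := exists_analytic_cofactor_algebraNorm (A := A)
  have hinv_cof : ∀ {a : A}, IsUnit a → Ring.inverse a = (Algebra.norm ℝ a)⁻¹ • cof a := by
    intro a ha
    obtain ⟨v, rfl⟩ := ha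
    rw [Ring.inverse_unit]
    have hv : cof (v : A) = Algebra.norm ℝ (v : A) • ((v⁻¹ : Aˣ) : A) := by
      calc cof (v : A) = ((v⁻¹ : Aˣ) : A) * ((v : A) * cof (v : A)) := by
            rw [← mul_assoc, Units.inv_mul, one_mul]
        _ = ((v⁻¹ : Aˣ) : A) * algebraMap ℝ A (Algebra.norm ℝ (v : A)) := by rw [hmul_cof]
        _ = Algebra.norm ℝ (v : A) • ((v⁻¹ : Aˣ) : A) := by
            rw [Algebra.algebraMap_eq_smul_one, mul_smul_comm, mul_one]
    rw [hv, smul_smul, inv_mul_cancel₀ ((Units.isUnit v).map (Algebra.norm ℝ)).ne_zero, one_smul]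
  have hu1 : u 1 = applyFree ι p φ g₀ := by
    change applyFree ι (FreeAlgebra.lift ℝ (FreeAlgebra.ι ℝ ∘ H.Ad 1) p) φ g₀ = _
    rw [lift_Ad_one]
  -- `u` over the word basis
  have hu : ∀ k : H.carrier, u k = ∑ w ∈ (b.repr p).support,
      (b.repr p w : ℂ) * iterLieDeriv ι ((FreeMonoid.toList w).map (H.Ad k)) φ g₀ := by
    intro k
    change applyFree ι (FreeAlgebra.lift ℝ (FreeAlgebra.ι ℝ ∘ H.Ad k) p) φ g₀ = _
    rw [applyFree_lift_comp]
    simp only [Finsupp.sum, Finset.sum_apply, Pi.smul_apply, smul_eq_mul]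
    rfl
  -- the affine curve from `1` to `h`
  set M : Matrix N N A := ((h : GL N A) : Matrix N N A) with hM
  let c : ℝ → Matrix N N A := fun t => (1 - t) • (1 : Matrix N N A) + t • M
  have hc0 : c 0 = 1 := by simp [c]
  have hc1 : c 1 = M := by simp [c]
  -- the lengths of the words of `p`, their maximum, the letters and the multilinear maps `Λ_w`
  let len : FreeMonoid H.lie → ℕ := fun w => (FreeMonoid.toList w).length
  let Mx : ℕ := (b.repr p).support.sup len
  let X : ∀ w : FreeMonoid H.lie, Fin (len w) → Matrix N N A :=
    fun w i => (((FreeMonoid.toList w)[(i : ℕ)] : H.lie) : Matrix N N A)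
  let Λ : ∀ w : FreeMonoid H.lie,
      ContinuousMultilinearMap ℝ (fun _ : Fin (len w) => Matrix N N A) ℂ :=
    fun w => iterLieDerivCML hH hc ψ g₀ (len w)
  -- the rescaled conjugate `Y_X(t) = N(det c t) • Ad(c t) X`, polynomial in `t`
  let Yf : Matrix N N A → ℝ → Matrix N N A :=
    fun Xm t => c t * Xm * (cof (c t).det • (c t).adjugate)
  -- the analytic function `P` and its normalisation `Q`
  let P : ℝ → ℂ := fun t => ∑ w ∈ (b.repr p).support,
    (b.repr p w : ℂ) * (((Algebra.norm ℝ (c t).det : ℝ) : ℂ) ^ (Mx - len w) *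
      Λ w (fun i => Yf (X w i) t))
  let Q : ℝ → ℂ := fun t => P t - ((Algebra.norm ℝ (c t).det : ℝ) : ℂ) ^ Mx * u 1
  /- (1) `P t = N(det c t)^Mx · u k` whenever `c t = k` is invertible -/
  have hkey : ∀ (t : ℝ) (k : H.carrier), ((k : GL N A) : Matrix N N A) = c t →
      P t = ((Algebra.norm ℝ (c t).det : ℝ) : ℂ) ^ Mx * u k := by
    intro t k hk
    have hdetU : IsUnit (c t).det := by
      rw [← hk]
      exact Matrix.isUnits_det_units _
    have hN0 : Algebra.norm ℝ (c t).det ≠ 0 := (hdetU.map (Algebra.norm ℝ)).ne_zero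
    -- the inverse of `k` through the cofactor
    have hinv : ((((k : GL N A)⁻¹ : GL N A)) : Matrix N N A) =
        (Algebra.norm ℝ (c t).det)⁻¹ • (cof (c t).det • (c t).adjugate) := by
      rw [Matrix.coe_units_inv, hk, Matrix.inv_def, hinv_cof hdetU, smul_assoc]
    -- `Y_X(t) = N • Ad(k) X`
    have hY : ∀ Xm : Matrix N N A, Yf Xm t = Algebra.norm ℝ (c t).det •
        (((k : GL N A) : Matrix N N A) * Xm * ((((k : GL N A)⁻¹ : GL N A)) : Matrix N N A)) := by
      intro Xm
      rw [hinv, hk, Matrix.mul_smul, smul_smul, mul_inv_cancel₀ hN0, one_smul]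
    -- the summands
    have hterm : ∀ w ∈ (b.repr p).support, Λ w (fun i => Yf (X w i) t) =
        ((Algebra.norm ℝ (c t).det : ℝ) : ℂ) ^ len w *
          iterLieDeriv ι ((FreeMonoid.toList w).map (H.Ad k)) φ g₀ := by
      intro w _
      have h1 : (fun i => Yf (X w i) t) = fun i : Fin (len w) => Algebra.norm ℝ (c t).det •
          ((H.Ad k ((FreeMonoid.toList w)[(i : ℕ)]) : H.lie) : Matrix N N A) := by
        funext i
        rw [hY, RealMatrixGroup.Ad_apply_coe]
      rw [h1, ContinuousMultilinearMap.map_smul_univ, Finset.prod_const, Finset.card_univ,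
        Fintype.card_fin]
      change Algebra.norm ℝ (c t).det ^ len w • iterLieDerivCML hH hc ψ g₀ (len w) _ = _
      rw [iterLieDerivCML_apply]
      simp only [RealMatrixGroup.lieOfTop_coe]
      rw [Complex.real_smul, Complex.ofReal_pow,
        ← List.ofFn_getElem_eq_map (FreeMonoid.toList w) (H.Ad k)]
    rw [hu k, Finset.mul_sum]
    refine Finset.sum_congr rfl fun w hw => ?_
    rw [hterm w hw, ← mul_assoc (((Algebra.norm ℝ (c t).det : ℝ) : ℂ) ^ (Mx - len w)), ← pow_add,
      Nat.sub_add_cancel (Finset.le_sup (f := len) hw)]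
    ring
  /- (2) `Q` is real-analytic on all of `ℝ` -/
  have hc_an : ∀ (a e : N) (t : ℝ), AnalyticAt ℝ (fun s => c s a e) t := by
    intro a e t
    simp only [c, Matrix.add_apply, Matrix.smul_apply]
    exact ((analyticAt_const.sub analyticAt_id).smul analyticAt_const).add
      (analyticAt_id.smul analyticAt_const)
  have hdet_an : ∀ t : ℝ, AnalyticAt ℝ (fun s => (c s).det) t := fun t =>
    analyticAt_det_of_entries fun a e => hc_an a e t
  have hadj_an : ∀ (a e : N) (t : ℝ), AnalyticAt ℝ (fun s => (c s).adjugate a e) t :=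
    fun a e t => analyticAt_adjugate_entry_of_entries (fun a e => hc_an a e t) a e
  have hN_an : ∀ t : ℝ, AnalyticAt ℝ (fun s => Algebra.norm ℝ (c s).det) t := fun t =>
    (analyticAt_algebraNorm _).comp (hdet_an t)
  have hCof_an : ∀ t : ℝ, AnalyticAt ℝ (fun s => cof (c s).det) t := fun t =>
    (hcof_an _).comp (hdet_an t)
  have hNC_an : ∀ t : ℝ, AnalyticAt ℝ (fun s => ((Algebra.norm ℝ (c s).det : ℝ) : ℂ)) t := fun t =>
    (Complex.ofRealCLM.analyticAt _).comp (hN_an t)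
  -- entries of `Y_X`
  have hYe_an : ∀ (Xm : Matrix N N A) (a e : N) (t : ℝ),
      AnalyticAt ℝ (fun s => Yf Xm s a e) t := by
    intro Xm a e t
    simp only [Yf, Matrix.mul_apply, Matrix.smul_apply, smul_eq_mul]
    refine Finset.analyticAt_fun_sum _ fun j _ => ?_
    refine (Finset.analyticAt_fun_sum _ fun l _ => (hc_an a l t).mul analyticAt_const).mul ?_
    exact (hCof_an t).mul (hadj_an j e t)
  -- `Y_X` as a map into the Banach space `M_N(A)`
  let eM : (N → N → A) ≃L[ℝ] Matrix N N A := (Matrix.ofLinearEquiv ℝ).toContinuousLinearEquiv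
  have hY_an : ∀ (Xm : Matrix N N A) (t : ℝ), AnalyticAt ℝ (Yf Xm) t := by
    intro Xm t
    have hpi : AnalyticAt ℝ (fun s => fun a e => Yf Xm s a e) t :=
      AnalyticAt.pi fun a => AnalyticAt.pi fun e => hYe_an Xm a e t
    have hcomp := (eM.analyticAt _).comp hpi
    have heq : ((eM : (N → N → A) → Matrix N N A) ∘ fun s a e => Yf Xm s a e) = Yf Xm := by
      funext s
      ext a e
      rfl
    rwa [heq] at hcomp
  have hΛ_an : ∀ (w : FreeMonoid H.lie) (t : ℝ),
      AnalyticAt ℝ (fun s => Λ w (fun i => Yf (X w i) s)) t := fun w t =>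
    ((Λ w).analyticAt).comp (AnalyticAt.pi fun i => hY_an (X w i) t)
  have hP_an : ∀ t : ℝ, AnalyticAt ℝ P t := fun t =>
    Finset.analyticAt_fun_sum _ fun w _ =>
      analyticAt_const.mul (((hNC_an t).pow _).mul (hΛ_an w t))
  have hQ_an : AnalyticOnNhd ℝ Q Set.univ := fun t _ =>
    (hP_an t).sub (((hNC_an t).pow Mx).mul analyticAt_const)
  /- (3) `Q = 0` near `t = 0`: there `c t = exp Y` and the identity-component theorem applies -/
  have hexp : Set.range (NormedSpace.exp : Matrix N N A → Matrix N N A) ∈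
      𝓝 (1 : Matrix N N A) := by
    have hder : HasStrictFDerivAt (NormedSpace.exp : Matrix N N A → Matrix N N A)
        ((ContinuousLinearEquiv.refl ℝ (Matrix N N A) : Matrix N N A ≃L[ℝ] Matrix N N A) :
          Matrix N N A →L[ℝ] Matrix N N A) 0 :=
      (hasStrictFDerivAt_exp_zero (𝕂 := ℝ) (𝔸 := Matrix N N A)).congr_fderiv (by
        ext X
        simp)
    have hmap : map NormedSpace.exp (𝓝 (0 : Matrix N N A)) = 𝓝 1 := by
      have h := hder.map_nhds_eq_of_equiv
      rwa [NormedSpace.exp_zero] at h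
    rw [← hmap]
    exact range_mem_map
  have hc_cont : Continuous c :=
    ((continuous_const.sub continuous_id).smul continuous_const).add
      (continuous_id.smul continuous_const)
  have hev : ∀ᶠ t in 𝓝 (0 : ℝ),
      c t ∈ Set.range (NormedSpace.exp : Matrix N N A → Matrix N N A) := by
    have ht : Tendsto c (𝓝 0) (𝓝 (1 : Matrix N N A)) := by
      have h0 := hc_cont.tendsto 0
      rwa [hc0] at h0
    exact ht.eventually_mem hexp
  have hQ0 : Q =ᶠ[𝓝 0] 0 := by
    filter_upwards [hev] with t ht
    obtain ⟨Yt, hYt⟩ := ht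
    let Y : H.lie := RealMatrixGroup.lieOfTop hH Yt
    have hk : (((H.expMem Y : H.carrier) : GL N A) : Matrix N N A) = c t := by
      rw [RealMatrixGroup.coe_expMem, coe_expGL, RealMatrixGroup.coe_lieOfTop, hYt]
    have h1 := hkey t (H.expMem Y) hk
    have h2 : u (H.expMem Y) = u 1 := by
      rw [hu1]
      change applyFree ι (FreeAlgebra.lift ℝ (FreeAlgebra.ι ℝ ∘ H.Ad (H.expMem Y)) p) φ g₀ = _
      rw [applyFree_lift_Ad_expMem_of_isCentralWord ι hH hc Y hp hφ]
    change P t - ((Algebra.norm ℝ (c t).det : ℝ) : ℂ) ^ Mx * u 1 = 0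
    rw [h1, h2, sub_self]
  /- (4) analytic continuation to `t = 1` -/
  have hQ1 : Q 1 = 0 :=
    hQ_an.eqOn_zero_of_preconnected_of_eventuallyEq_zero isPreconnected_univ (Set.mem_univ 0) hQ0
      (Set.mem_univ 1)
  have hh1 : ((h : GL N A) : Matrix N N A) = c 1 := by rw [hc1, hM]
  have hP1 : P 1 = ((Algebra.norm ℝ (c 1).det : ℝ) : ℂ) ^ Mx * u h := hkey 1 h hh1
  have hN1 : ((Algebra.norm ℝ (c 1).det : ℝ) : ℂ) ^ Mx ≠ 0 := by
    refine pow_ne_zero _ (Complex.ofReal_ne_zero.2 ?_)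
    have hdetU : IsUnit (c 1).det := by
      rw [← hh1]
      exact Matrix.isUnits_det_units _
    exact (hdetU.map (Algebra.norm ℝ)).ne_zero
  have hfinal : u h = u 1 := by
    have h0 : ((Algebra.norm ℝ (c 1).det : ℝ) : ℂ) ^ Mx * (u h - u 1) = 0 := by
      rw [mul_sub, ← hP1]
      exact hQ1
    exact sub_eq_zero.1 ((mul_eq_zero.1 h0).resolve_left hN1)
  change u h = applyFree ι p φ g₀
  rw [hfinal, hu1]

/-- **Central words commute with right translation by EVERY element of the archimedean group**:
for `p ∈ ℝ⟨𝔤⟩` central, `φ` smooth and `h ∈ GL(N, A)`, `p (r(h) φ) = r(h) (p φ)`.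
Borel 1997, 2.3 (3) and 2.5 ("`D` commutes with right translations"); Borel–Jacquet 1979, §1.6,
4.3 (ii). [cite: Borel1997, 2.5 (PDF p. 15)] -/
theorem applyFree_archTranslate_of_isCentralWord (hH : H.lie = ⊤) (hc : H.carrier = ⊤)
    (h : H.carrier) {p : FreeAlgebra ℝ H.lie} (hp : IsCentralWord p) {φ : G → ℂ}
    (hφ : IsArchSmooth ι φ) :
    applyFree ι p (archTranslate ι h φ) = archTranslate ι h (applyFree ι p φ) := by
  rw [applyFree_archTranslate, applyFree_lift_Ad_of_isCentralWord ι hH hc h⁻¹ hp hφ]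

end Central

/-! ### 4. The `GL_n` datum -/

section GLDatum

open NumberField NumberField.mixedEmbedding
open scoped Classical

variable {n : ℕ} {K : Type} [Field K] [NumberField K]

/-- **`Z(𝔤)` commutes with right translation by every element of `GL_n(K_∞)`**: for the datum
`AutomorphyDatum.gl n K hcpt`, `p` a central word, `φ` smooth in the archimedean variable and ANY
`x ∈ GL_n(K_∞)` (all connected components), `p (r(x) φ) = r(x) (p φ)` (`r(x)` = right translation
by `GLn.ofInfinite x`). Borel 1997, 2.3 (3), 2.5; Borel–Jacquet 1979, 4.3 (ii).
[cite: Borel1997, 2.5 (PDF p. 15)] -/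
theorem applyFree_rightTranslation_ofInfinite (hcpt : isCompact_glFiniteIntegralLevel n K)
    {p : FreeAlgebra ℝ (archGroupGL n K).lie} (hp : IsCentralWord p)
    {φ : (AdelicGroupData.gl n K).Adelic → ℂ} (hφ : IsArchSmooth (AutomorphyDatum.gl n K hcpt).ofArch φ)
    (x : GL (Fin n) (mixedSpace K)) :
    applyFree (AutomorphyDatum.gl n K hcpt).ofArch p
        (rightTranslation (AdelicGroupData.gl n K) (GLn.ofInfinite n K x) φ) =
      rightTranslation (AdelicGroupData.gl n K) (GLn.ofInfinite n K x)
        (applyFree (AutomorphyDatum.gl n K hcpt).ofArch p φ) := by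
  let y : (archGroupGL n K).carrier := ⟨x, by rw [archGroupGL_carrier]; exact Subgroup.mem_top x⟩
  have hr : rightTranslation (AdelicGroupData.gl n K) (GLn.ofInfinite n K x) =
      archTranslate (AutomorphyDatum.gl n K hcpt).ofArch y := by
    rw [AutomorphyDatum.archTranslate_ofArch, AutomorphyDatum.gl_ofArch_apply]
  rw [hr]
  exact applyFree_archTranslate_of_isCentralWord _ (archGroupGL_lie n K)
    (archGroupGL_carrier n K) y hp hφ

end GLDatum

end Literature.NumberTheory.Automorphic
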